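import Mathlib
import HarnessLib
import Summits.Ventures.LatticeQCDFlow.Scaling.PlaquetteSharedLinkManyPeeling
import Summits.Ventures.LatticeQCDFlow.Scaling.AutoregressiveGaugeHeatBathAnyDim

/-!
# LatticeQCDFlow / Scaling — the ALL-CLOSING-PLAQUETTES heat-bath autoregression (the conditioner that scores
# every plaquette a link closes) is a normalised proposal along any closing assignment, and its importance
# ratio against the target is `∏_ℓ N_ℓ(U)/Z` with `m^{j_ℓ−1}·c ≤ N_ℓ ≤ c_{j_ℓ}`

HONEST FRAMING: exact (Metropolis-corrected) sampling algorithms for lattice gauge theory;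
figures of merit are autocorrelation/cost numbers at stated couplings and volumes; no
continuum-physics claim.

Venture `LatticeQCDFlow` (cell pub-lqcd), topic `Scaling`, FANOUT row 30 (lean-1, GEN-27) — OUR WORK on
THEORY-2.md §4 row C5 (gen25 Q3 ∕ gen26 README «NEXT MATHEMATICS» (4): CONDITIONERS BEYOND ONE-PLAQUETTE HEAT
BATHS).  Links of `(ℤ/L)^d` are generated in some order; a CLOSING ASSIGNMENT gives each generated link `ℓ` of a
set `T` a finite set `C ℓ` of plaquettes that contain `ℓ` and whose other three links come EARLIER (`pos`
smaller).  The all-closing conditioner draws `U_ℓ` with density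
`q_ℓ(U) = (∏_{p∈C ℓ} w(U_p)) / N_ℓ(U)`, `N_ℓ(U) = ∫ ∏_{p∈C ℓ} w(U[ℓ ↦ v]_p) dHaar(v)` (a function of the
earlier links only); the one-plaquette heat bath of GEN-23/24 is the case `#C ℓ ≤ 1`.

* §1 the normaliser: `m^{#Cℓ} ≤ N_ℓ(U) ≤ M^{#Cℓ}`, and `N_ℓ(U) ≤ c_{#Cℓ} = ∫ w^{#Cℓ} dHaar` when `C ℓ ≠ ∅`
  (`PlaquetteSharedLinkManyPeeling.integral_update_prod_plaquettes_le`, AM–GM); `N_ℓ` is blind to `U_ℓ` and to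
  every link of larger position; measurable in `U`;
* §2 **`integral_prod_allClosing_conditioner_eq_one`** — NORMALISATION: `∫ ∏_{ℓ∈T} q_ℓ(U) dHaar^{⊗E}(U) = 1`
  (induction on the maximal position: the last factor integrates to `1` in its own link, the others do not
  see that link) — the all-closing autoregression is a genuine proposal law `q = (∏_ℓ q_ℓ)·Haar^{⊗E}`;
* §3 **`prod_allClosing_conditioner_eq`** — when the `C ℓ` PARTITION the plaquettes (every plaquette closed
  exactly once), `∏_ℓ q_ℓ(U) = F(U)/∏_ℓ N_ℓ(U)` with `F = ∏_p w(U_p)`: against the target `π = (F/Z)·Haar^{⊗E}`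
  the importance ratio is `(π/q)(U) = ∏_ℓ N_ℓ(U)/Z`, squeezed between `∏_ℓ m^{#Cℓ}/Z` and
  `∏_ℓ min(M^{#Cℓ}, c_{#Cℓ})/Z` (sharper: `m^{#Cℓ−1}·c ≤ N_ℓ`, **`normaliser_ge`**); with `TorusClosingLinks` (`Σ_ℓ (#Cℓ − 1) ≥ k_min(d, L)` along every order)
  this is where the volume enters for this conditioner too.

No `def` (the conditioner, its normaliser and the assignment are hypotheses ∕ spelled-out terms), no `sorry`,
nothing cited as a fact beyond the tree.
-/

noncomputable section

namespace Summit.Ventures.LatticeQCDFlow.Theory2.Autoregressive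

open MeasureTheory Function Finset
open Literature.MathematicalPhysics.QuantumFieldTheory Literature.MathematicalPhysics.QuantumLattice
open Summit.Ventures.LatticeQCDFlow.Exactness

variable {d L : ℕ} [NeZero L] {G : Type*} [Group G] [TopologicalSpace G] [IsTopologicalGroup G]
  [CompactSpace G] [SecondCountableTopology G] [MeasurableSpace G] [BorelSpace G]

/-! ## §1 The normaliser -/

omit [NeZero L] [SecondCountableTopology G] in
/-- **Squeeze of the normaliser**: `m^{#C} ≤ N(U) ≤ M^{#C}` for `0 < m ≤ w ≤ M`. [ours] -/
theorem pow_le_normaliser_le_pow {w : G → ℝ} (hw : Continuous w) {m M : ℝ} (hm0 : 0 < m) (hm : ∀ g, m ≤ w g)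
    (hM : ∀ g, w g ≤ M) (C : Finset (Plaquette d L)) (ℓ : Edge d L) (U : GaugeConfig d L G) :
    m ^ C.card ≤ ∫ v, ∏ p ∈ C, w (plaquetteHolonomy (update U ℓ v) p.1 p.2.1.1 p.2.1.2) ∂(haarProbability G) ∧
      ∫ v, ∏ p ∈ C, w (plaquetteHolonomy (update U ℓ v) p.1 p.2.1.1 p.2.1.2) ∂(haarProbability G) ≤ M ^ C.card := by
  have hcont : Continuous fun v : G => ∏ p ∈ C, w (plaquetteHolonomy (update U ℓ v) p.1 p.2.1.1 p.2.1.2) :=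
    (continuous_prodPlaquetteWeight_anyDim hw C).comp (continuous_const.update ℓ continuous_id)
  have hint : Integrable (fun v : G => ∏ p ∈ C, w (plaquetteHolonomy (update U ℓ v) p.1 p.2.1.1 p.2.1.2)) (haarProbability G) :=
    Literature.Probability.LatticeModels.integrable_of_continuous_compactSpace _ hcont
  constructor
  · have h := integral_mono (integrable_const (m ^ C.card)) hint
      fun v => (pow_le_prodPlaquetteWeight_le_pow_anyDim hm0 hm hM C (update U ℓ v)).1
    simpa using h
  · have h := integral_mono hint (integrable_const (M ^ C.card))
      fun v => (pow_le_prodPlaquetteWeight_le_pow_anyDim hm0 hm hM C (update U ℓ v)).2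
    simpa using h

omit [NeZero L] [SecondCountableTopology G] in
/-- The normaliser does not see the link it integrates. [ours] -/
theorem normaliser_update_self (w : G → ℝ) (C : Finset (Plaquette d L)) (ℓ : Edge d L) (U : GaugeConfig d L G)
    (g : G) :
    ∫ v, ∏ p ∈ C, w (plaquetteHolonomy (update (update U ℓ g) ℓ v) p.1 p.2.1.1 p.2.1.2) ∂(haarProbability G) =
      ∫ v, ∏ p ∈ C, w (plaquetteHolonomy (update U ℓ v) p.1 p.2.1.1 p.2.1.2) ∂(haarProbability G) := by
  simp only [update_idem]

omit [NeZero L] [SecondCountableTopology G] in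
/-- The normaliser does not see a link `e ≠ ℓ` lying on no plaquette of `C`. [ours] -/
theorem normaliser_update_of_forall_notMem (w : G → ℝ) (C : Finset (Plaquette d L)) (ℓ : Edge d L)
    {e : Edge d L} (he : e ≠ ℓ) (hC : ∀ p ∈ C, e ∉ ({(p.1, p.2.1.1), (p.1.shift p.2.1.1, p.2.1.2),
        (p.1.shift p.2.1.2, p.2.1.1), (p.1, p.2.1.2)} : Finset (Edge d L)))
    (U : GaugeConfig d L G) (g : G) :
    ∫ v, ∏ p ∈ C, w (plaquetteHolonomy (update (update U e g) ℓ v) p.1 p.2.1.1 p.2.1.2) ∂(haarProbability G) =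
      ∫ v, ∏ p ∈ C, w (plaquetteHolonomy (update U ℓ v) p.1 p.2.1.1 p.2.1.2) ∂(haarProbability G) := by
  refine integral_congr_ae (ae_of_all _ fun v => Finset.prod_congr rfl fun p hp => ?_)
  rw [update_comm he]
  have h := hC p hp
  simp only [Finset.mem_insert, Finset.mem_singleton, not_or] at h
  obtain ⟨h1, h2, h3, h4⟩ := h
  rw [plaquetteHolonomy_update_of_ne _ g (Ne.symm h1) (Ne.symm h2) (Ne.symm h3) (Ne.symm h4)]

/-- The normaliser is a measurable function of the configuration (a continuous parametric integrand over a
second-countable compact group). [ours] -/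
theorem measurable_normaliser {w : G → ℝ} (hw : Continuous w) (C : Finset (Plaquette d L)) (ℓ : Edge d L) :
    Measurable fun U : GaugeConfig d L G =>
      ∫ v, ∏ p ∈ C, w (plaquetteHolonomy (update U ℓ v) p.1 p.2.1.1 p.2.1.2) ∂(haarProbability G) := by
  have hcont : Continuous fun q : GaugeConfig d L G × G =>
      ∏ p ∈ C, w (plaquetteHolonomy (update q.1 ℓ q.2) p.1 p.2.1.1 p.2.1.2) :=
    (continuous_prodPlaquetteWeight_anyDim hw C).comp (continuous_fst.update ℓ continuous_snd)
  exact (hcont.stronglyMeasurable.integral_prod_right' (ν := haarProbability G)).measurable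

/-! ## §2 Normalisation of the all-closing autoregression -/

/-- **THE ALL-CLOSING AUTOREGRESSION IS NORMALISED.**  `L ≥ 2` not needed; `w` continuous, `0 < m ≤ w ≤ M`;
`T` a finite set of links with positions `pos`; `C ℓ` (for `ℓ ∈ T`) plaquettes all of whose links other than `ℓ`
have SMALLER position than `ℓ` (that they contain `ℓ` is not even needed here).  Then
`∫ ∏_{ℓ∈T} (∏_{p∈C ℓ} w(U_p)) / N_ℓ(U) dHaar^{⊗E} = 1`,
`N_ℓ(U) = ∫ ∏_{p∈C ℓ} w(U[ℓ ↦ v]_p) dHaar(v)`: peel the link of maximal position — its factor integrates to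
`1` in its own coordinate and no other factor sees that coordinate. [ours] -/
theorem integral_prod_allClosing_conditioner_eq_one {w : G → ℝ} (hw : Continuous w) {m M : ℝ} (hm0 : 0 < m)
    (hm : ∀ g, m ≤ w g) (hM : ∀ g, w g ≤ M) (T : Finset (Edge d L)) (pos : Edge d L → ℕ)
    (C : Edge d L → Finset (Plaquette d L))
    (hCpos : ∀ ℓ ∈ T, ∀ p ∈ C ℓ, ∀ e ∈ ({(p.1, p.2.1.1), (p.1.shift p.2.1.1, p.2.1.2),
        (p.1.shift p.2.1.2, p.2.1.1), (p.1, p.2.1.2)} : Finset (Edge d L)), e ≠ ℓ → pos e < pos ℓ) :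
    ∫ U, ∏ ℓ ∈ T, (∏ p ∈ C ℓ, w (plaquetteHolonomy U p.1 p.2.1.1 p.2.1.2)) /
        (∫ v, ∏ p ∈ C ℓ, w (plaquetteHolonomy (update U ℓ v) p.1 p.2.1.1 p.2.1.2) ∂(haarProbability G)) ∂(Measure.pi fun _ : Edge d L => haarProbability G) = 1 := by
  classical
  set μ := haarProbability G with hμ
  have hw0 : ∀ g, 0 < w g := fun g => hm0.trans_le (hm g)
  have hMpos : 0 < M := (hw0 1).trans_le (hM 1)
  haveI : IsProbabilityMeasure (Measure.pi fun _ : Edge d L => haarProbability G) := by infer_instance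
  -- abbreviations for the factor of a link
  have hPpos : ∀ (ℓ : Edge d L) (U : GaugeConfig d L G), 0 < ∏ p ∈ C ℓ, w (plaquetteHolonomy U p.1 p.2.1.1 p.2.1.2) :=
    fun ℓ U => prod_pos fun p _ => hw0 _
  have hNpos : ∀ (ℓ : Edge d L) (U : GaugeConfig d L G),
      0 < ∫ v, ∏ p ∈ C ℓ, w (plaquetteHolonomy (update U ℓ v) p.1 p.2.1.1 p.2.1.2) ∂μ := fun ℓ U =>
    lt_of_lt_of_le (pow_pos hm0 _) (pow_le_normaliser_le_pow hw hm0 hm hM (C ℓ) ℓ U).1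
  have hfac_le : ∀ (ℓ : Edge d L) (U : GaugeConfig d L G),
      (∏ p ∈ C ℓ, w (plaquetteHolonomy U p.1 p.2.1.1 p.2.1.2)) /
        (∫ v, ∏ p ∈ C ℓ, w (plaquetteHolonomy (update U ℓ v) p.1 p.2.1.1 p.2.1.2) ∂μ) ≤ M ^ (C ℓ).card / m ^ (C ℓ).card := by
    intro ℓ U
    exact div_le_div₀ (pow_nonneg hMpos.le _) (pow_le_prodPlaquetteWeight_le_pow_anyDim hm0 hm hM (C ℓ) U).2
      (pow_pos hm0 _) (pow_le_normaliser_le_pow hw hm0 hm hM (C ℓ) ℓ U).1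
  have hfac_meas : ∀ ℓ : Edge d L, Measurable fun U : GaugeConfig d L G =>
      (∏ p ∈ C ℓ, w (plaquetteHolonomy U p.1 p.2.1.1 p.2.1.2)) /
        (∫ v, ∏ p ∈ C ℓ, w (plaquetteHolonomy (update U ℓ v) p.1 p.2.1.1 p.2.1.2) ∂μ) := fun ℓ =>
    (continuous_prodPlaquetteWeight_anyDim hw (C ℓ)).measurable.div (measurable_normaliser hw (C ℓ) ℓ)
  revert hCpos
  refine Finset.induction_on_max_value pos T ?_ ?_
  · intro _
    simp
  · intro a s has hmax ih hCpos
    have hCposs : ∀ ℓ ∈ s, ∀ p ∈ C ℓ, ∀ e ∈ ({(p.1, p.2.1.1), (p.1.shift p.2.1.1, p.2.1.2),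
        (p.1.shift p.2.1.2, p.2.1.1), (p.1, p.2.1.2)} : Finset (Edge d L)), e ≠ ℓ → pos e < pos ℓ :=
      fun ℓ hℓ => hCpos ℓ (Finset.mem_insert_of_mem hℓ)
    have ih' := ih hCposs
    -- no plaquette of `C ℓ`, `ℓ ∈ s`, contains `a`
    have hfree : ∀ ℓ ∈ s, ∀ p ∈ C ℓ, a ∉ ({(p.1, p.2.1.1), (p.1.shift p.2.1.1, p.2.1.2),
        (p.1.shift p.2.1.2, p.2.1.1), (p.1, p.2.1.2)} : Finset (Edge d L)) := by
      intro ℓ hℓ p hp hmem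
      have hne : a ≠ ℓ := fun h => has (h ▸ hℓ)
      have h1 := hCpos ℓ (Finset.mem_insert_of_mem hℓ) p hp a hmem hne
      exact absurd (hmax ℓ hℓ) (not_le.2 h1)
    -- the product over `s` is blind to the coordinate `a`
    set Φ : GaugeConfig d L G → ℝ := fun U => ∏ ℓ ∈ s, (∏ p ∈ C ℓ, w (plaquetteHolonomy U p.1 p.2.1.1 p.2.1.2)) /
        (∫ v, ∏ p ∈ C ℓ, w (plaquetteHolonomy (update U ℓ v) p.1 p.2.1.1 p.2.1.2) ∂μ) with hΦ
    have hΦe : ∀ U g, Φ (update U a g) = Φ U := by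
      intro U g
      simp only [hΦ]
      refine Finset.prod_congr rfl fun ℓ hℓ => ?_
      have hne : a ≠ ℓ := fun h => has (h ▸ hℓ)
      congr 1
      · refine Finset.prod_congr rfl fun p hp => ?_
        have h := hfree ℓ hℓ p hp
        simp only [Finset.mem_insert, Finset.mem_singleton, not_or] at h
        obtain ⟨h1, h2, h3, h4⟩ := h
        rw [plaquetteHolonomy_update_of_ne U g (Ne.symm h1) (Ne.symm h2) (Ne.symm h3) (Ne.symm h4)]
      · exact normaliser_update_of_forall_notMem w (C ℓ) ℓ hne (hfree ℓ hℓ) U g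
    have hΦm : Measurable Φ := Finset.measurable_prod s fun ℓ _ => hfac_meas ℓ
    have hΦpos : ∀ U, 0 < Φ U := fun U => prod_pos fun ℓ _ => div_pos (hPpos ℓ U) (hNpos ℓ U)
    have hΦb : ∀ U, Φ U ≤ ∏ ℓ ∈ s, M ^ (C ℓ).card / m ^ (C ℓ).card := fun U =>
      Finset.prod_le_prod (fun ℓ _ => (div_pos (hPpos ℓ U) (hNpos ℓ U)).le) fun ℓ _ => hfac_le ℓ U
    -- integrability of the full product
    set Fa : GaugeConfig d L G → ℝ := fun U => (∏ p ∈ C a, w (plaquetteHolonomy U p.1 p.2.1.1 p.2.1.2)) /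
        (∫ v, ∏ p ∈ C a, w (plaquetteHolonomy (update U a v) p.1 p.2.1.1 p.2.1.2) ∂μ) with hFa
    have hFi : Integrable (fun U => Fa U * Φ U) (Measure.pi fun _ : Edge d L => haarProbability G) := by
      refine Integrable.mono' (integrable_const ((M ^ (C a).card / m ^ (C a).card) *
        ∏ ℓ ∈ s, M ^ (C ℓ).card / m ^ (C ℓ).card)) ((hfac_meas a).mul hΦm).aestronglyMeasurable
        (ae_of_all _ fun U => ?_)
      rw [Real.norm_eq_abs, abs_of_pos (mul_pos (div_pos (hPpos a U) (hNpos a U)) (hΦpos U))]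
      exact mul_le_mul (hfac_le a U) (hΦb U) (hΦpos U).le
        (div_nonneg (pow_nonneg hMpos.le _) (pow_nonneg hm0.le _))
    have huniv : (fun _ : Edge d L => μ) a Set.univ ≠ 0 := by simp [hμ]
    have key : ∫ U, Fa U * Φ U ∂(Measure.pi fun _ : Edge d L => haarProbability G) = 1 := by
      rw [integral_pi_eq_integral_integral_update' (fun _ : Edge d L => μ) a huniv hFi]
      simp only [measure_univ, inv_one, ENNReal.toReal_one, one_smul]
      -- the inner integral: `Φ` comes out, the normaliser comes out, and what is left is the normaliser
      have hinner : ∀ U : GaugeConfig d L G, ∫ g, Fa (update U a g) * Φ (update U a g) ∂μ = Φ U := by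
        intro U
        simp only [hFa, update_idem, hΦe]
        rw [integral_mul_const, integral_div, div_self (hNpos a U).ne', one_mul]
      simp_rw [hinner]
      exact ih'
    simp_rw [Finset.prod_insert has]
    simpa only [hFa, hΦ] using key

/-! ## §3 The importance ratio against the target -/

omit [TopologicalSpace G] [IsTopologicalGroup G] [CompactSpace G] [SecondCountableTopology G]
  [MeasurableSpace G] [BorelSpace G] in
/-- When the closing sets PARTITION the plaquettes, the numerators multiply to the full weight:
`∏_{ℓ∈T} ∏_{p∈C ℓ} w(U_p) = ∏_p w(U_p)`. [ours] -/
theorem prod_prod_closing_eq_prod_univ (w : G → ℝ) (T : Finset (Edge d L)) (C : Edge d L → Finset (Plaquette d L))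
    (hdisj : ∀ ℓ ∈ T, ∀ ℓ' ∈ T, ℓ ≠ ℓ' → Disjoint (C ℓ) (C ℓ'))
    (hcover : ∀ p : Plaquette d L, ∃ ℓ ∈ T, p ∈ C ℓ) (U : GaugeConfig d L G) :
    ∏ ℓ ∈ T, ∏ p ∈ C ℓ, w (plaquetteHolonomy U p.1 p.2.1.1 p.2.1.2) = ∏ p : Plaquette d L, w (plaquetteHolonomy U p.1 p.2.1.1 p.2.1.2) := by
  classical
  rw [← Finset.prod_biUnion (fun ℓ hℓ ℓ' hℓ' hne => hdisj ℓ hℓ ℓ' hℓ' hne)]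
  congr 1
  ext p
  simp only [Finset.mem_biUnion, Finset.mem_univ, iff_true]
  exact hcover p

omit [SecondCountableTopology G] in
/-- **THE IMPORTANCE RATIO OF THE ALL-CLOSING PROPOSAL.**  If the closing sets partition the plaquettes, then
pointwise `(F(U)/Z) / ∏_ℓ q_ℓ(U) = (∏_ℓ N_ℓ(U)) / Z` (`F = ∏_p w(U_p)`; `Z` any constant): the target-to-proposal
density ratio of the all-closing autoregression is the product of its normalisers over `Z`. [ours] -/
theorem target_div_allClosing_eq {w : G → ℝ} (hw : Continuous w) {m M : ℝ} (hm0 : 0 < m) (hm : ∀ g, m ≤ w g)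
    (hM : ∀ g, w g ≤ M) (T : Finset (Edge d L)) (C : Edge d L → Finset (Plaquette d L))
    (hdisj : ∀ ℓ ∈ T, ∀ ℓ' ∈ T, ℓ ≠ ℓ' → Disjoint (C ℓ) (C ℓ'))
    (hcover : ∀ p : Plaquette d L, ∃ ℓ ∈ T, p ∈ C ℓ) (Z : ℝ) (U : GaugeConfig d L G) :
    ((∏ p : Plaquette d L, w (plaquetteHolonomy U p.1 p.2.1.1 p.2.1.2)) / Z) /
        (∏ ℓ ∈ T, (∏ p ∈ C ℓ, w (plaquetteHolonomy U p.1 p.2.1.1 p.2.1.2)) /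
          (∫ v, ∏ p ∈ C ℓ, w (plaquetteHolonomy (update U ℓ v) p.1 p.2.1.1 p.2.1.2) ∂(haarProbability G))) =
      (∏ ℓ ∈ T, ∫ v, ∏ p ∈ C ℓ, w (plaquetteHolonomy (update U ℓ v) p.1 p.2.1.1 p.2.1.2) ∂(haarProbability G)) / Z := by
  have hw0 : ∀ g, 0 < w g := fun g => hm0.trans_le (hm g)
  have hP : ∀ ℓ, (∏ p ∈ C ℓ, w (plaquetteHolonomy U p.1 p.2.1.1 p.2.1.2)) ≠ 0 := fun ℓ => (prod_pos fun p _ => hw0 _).ne'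
  have hN : ∀ ℓ, (∫ v, ∏ p ∈ C ℓ, w (plaquetteHolonomy (update U ℓ v) p.1 p.2.1.1 p.2.1.2) ∂(haarProbability G)) ≠ 0 :=
    fun ℓ => (lt_of_lt_of_le (pow_pos hm0 _) (pow_le_normaliser_le_pow hw hm0 hm hM (C ℓ) ℓ U).1).ne'
  rw [Finset.prod_div_distrib, prod_prod_closing_eq_prod_univ w T C hdisj hcover U]
  have hF : (∏ p : Plaquette d L, w (plaquetteHolonomy U p.1 p.2.1.1 p.2.1.2)) ≠ 0 := (prod_pos fun p _ => hw0 _).ne'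
  have hNp : (∏ ℓ ∈ T, ∫ v, ∏ p ∈ C ℓ, w (plaquetteHolonomy (update U ℓ v) p.1 p.2.1.1 p.2.1.2) ∂(haarProbability G)) ≠ 0 :=
    Finset.prod_ne_zero_iff.2 fun ℓ _ => hN ℓ
  field_simp

omit [SecondCountableTopology G] in
/-- **Squeeze of the ratio's numerator**: `m^{Σ_ℓ #Cℓ} ≤ ∏_ℓ N_ℓ(U) ≤ ∏_ℓ c_{#Cℓ}` (`c_n = ∫ wⁿ dHaar`, with
`c_0 = 1` for links that close nothing; the upper bound is the many-plaquette constant of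
`PlaquetteSharedLinkManyPeeling`, the lower one the pointwise `w ≥ m`).  With `TorusClosingLinks`: along every
generation order of all links `Σ_ℓ (#Cℓ − 1)⁺ ≥ k_min(d, L)`, so the upper bound carries at least `k_min` factors
`c_{n+1}/(M·c_n)`-type below the one-plaquette value. [ours] -/
theorem prod_normaliser_le (hL : 2 ≤ L) {w : G → ℝ} (hw : Continuous w) {m M : ℝ} (hm0 : 0 < m)
    (hm : ∀ g, m ≤ w g) (hM : ∀ g, w g ≤ M) (T : Finset (Edge d L)) (C : Edge d L → Finset (Plaquette d L))
    (hCe : ∀ ℓ ∈ T, ∀ p ∈ C ℓ, ℓ ∈ ({(p.1, p.2.1.1), (p.1.shift p.2.1.1, p.2.1.2),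
        (p.1.shift p.2.1.2, p.2.1.1), (p.1, p.2.1.2)} : Finset (Edge d L))) (U : GaugeConfig d L G) :
    m ^ (∑ ℓ ∈ T, (C ℓ).card) ≤
        ∏ ℓ ∈ T, ∫ v, ∏ p ∈ C ℓ, w (plaquetteHolonomy (update U ℓ v) p.1 p.2.1.1 p.2.1.2) ∂(haarProbability G) ∧
      ∏ ℓ ∈ T, ∫ v, ∏ p ∈ C ℓ, w (plaquetteHolonomy (update U ℓ v) p.1 p.2.1.1 p.2.1.2) ∂(haarProbability G) ≤
        ∏ ℓ ∈ T, ∫ h, w h ^ (C ℓ).card ∂(haarProbability G) := by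
  have hw0 : ∀ g, 0 < w g := fun g => hm0.trans_le (hm g)
  have hN0 : ∀ ℓ, 0 ≤ ∫ v, ∏ p ∈ C ℓ, w (plaquetteHolonomy (update U ℓ v) p.1 p.2.1.1 p.2.1.2) ∂(haarProbability G) :=
    fun ℓ => integral_nonneg fun v => (prod_pos fun p _ => hw0 _).le
  constructor
  · rw [← Finset.prod_pow_eq_pow_sum]
    exact Finset.prod_le_prod (fun ℓ _ => pow_nonneg hm0.le _)
      fun ℓ _ => (pow_le_normaliser_le_pow hw hm0 hm hM (C ℓ) ℓ U).1
  · refine Finset.prod_le_prod (fun ℓ _ => hN0 ℓ) fun ℓ hℓ => ?_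
    rcases (C ℓ).eq_empty_or_nonempty with h0 | hne
    · simp [h0]
    · exact integral_update_prod_plaquettes_le hL hw (fun g => (hw0 g).le) U (C ℓ) hne (hCe ℓ hℓ)

omit [SecondCountableTopology G] in
/-- **Sharper lower bound of the normaliser**: `m^{#C−1}·c ≤ N_ℓ(U)` when `C ≠ ∅` and every plaquette of `C`
contains `ℓ` (`L ≥ 2`): all factors but one are `≥ m`, the last one integrates to `c = ∫ w dHaar` because a
redrawn link makes its plaquette's holonomy Haar (`integral_comp_plaquetteHolonomy_update_of_mem`).  With the
upper bound `N_ℓ ≤ c_{#C}`: `N_ℓ/(m^{#C−1}c) ≤ c_{#C}/(m^{#C−1}c) ≤ (M/m)^{#C−1}`. [ours] -/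
theorem normaliser_ge (hL : 2 ≤ L) {w : G → ℝ} (hw : Continuous w) {m : ℝ} (hm0 : 0 < m) (hm : ∀ g, m ≤ w g)
    (C : Finset (Plaquette d L)) (ℓ : Edge d L) {p₀ : Plaquette d L} (hp₀ : p₀ ∈ C)
    (hℓ : ℓ ∈ ({(p₀.1, p₀.2.1.1), (p₀.1.shift p₀.2.1.1, p₀.2.1.2),
        (p₀.1.shift p₀.2.1.2, p₀.2.1.1), (p₀.1, p₀.2.1.2)} : Finset (Edge d L))) (U : GaugeConfig d L G) :
    m ^ (C.card - 1) * ∫ g, w g ∂(haarProbability G) ≤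
      ∫ v, ∏ p ∈ C, w (plaquetteHolonomy (update U ℓ v) p.1 p.2.1.1 p.2.1.2) ∂(haarProbability G) := by
  classical
  have hw0 : ∀ g, 0 < w g := fun g => hm0.trans_le (hm g)
  have hcont : Continuous fun v : G => ∏ p ∈ C, w (plaquetteHolonomy (update U ℓ v) p.1 p.2.1.1 p.2.1.2) :=
    (continuous_prodPlaquetteWeight_anyDim hw C).comp (continuous_const.update ℓ continuous_id)
  have hint : Integrable (fun v : G => ∏ p ∈ C, w (plaquetteHolonomy (update U ℓ v) p.1 p.2.1.1 p.2.1.2)) (haarProbability G) :=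
    Literature.Probability.LatticeModels.integrable_of_continuous_compactSpace _ hcont
  have hc1 : Continuous fun v : G => w (plaquetteHolonomy (update U ℓ v) p₀.1 p₀.2.1.1 p₀.2.1.2) :=
    hw.comp ((Summit.Ventures.LatticeQCDFlow.Scoring.continuous_config_plaquetteHolonomy p₀.1 p₀.2.1.1 p₀.2.1.2).comp
      (continuous_const.update ℓ continuous_id))
  have hint1 : Integrable (fun v : G => m ^ (C.card - 1) * w (plaquetteHolonomy (update U ℓ v) p₀.1 p₀.2.1.1 p₀.2.1.2))
      (haarProbability G) :=
    (Literature.Probability.LatticeModels.integrable_of_continuous_compactSpace _ hc1).const_mul _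
  -- pointwise: all factors but `p₀` are `≥ m`
  have hpt : ∀ v : G, m ^ (C.card - 1) * w (plaquetteHolonomy (update U ℓ v) p₀.1 p₀.2.1.1 p₀.2.1.2) ≤
      ∏ p ∈ C, w (plaquetteHolonomy (update U ℓ v) p.1 p.2.1.1 p.2.1.2) := by
    intro v
    rw [← Finset.mul_prod_erase C _ hp₀, mul_comm]
    refine mul_le_mul_of_nonneg_left ?_ (hw0 _).le
    have hcard : (C.erase p₀).card = C.card - 1 := Finset.card_erase_of_mem hp₀
    rw [← hcard, ← Finset.prod_const]
    exact Finset.prod_le_prod (fun p _ => hm0.le) fun p _ => hm _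
  have h := integral_mono hint1 hint hpt
  rw [integral_const_mul, integral_comp_plaquetteHolonomy_update_of_mem hL p₀.1 (ne_of_lt p₀.2.2) hℓ w U]
    at h
  exact h

end Summit.Ventures.LatticeQCDFlow.Theory2.Autoregressive

end
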